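import Summits.BirchSwinnertonDyer.BirchSwinnertonDyer.Theorems.ErratumRoadFiveFixedPartOfFrame
import Summits.BirchSwinnertonDyer.BirchSwinnertonDyer.Theorems.ErratumRoadFiveLocalDefectOfFiniteFixed
import Literature.NumberTheory.EllipticCurves.CofreeFrameCoordinatesProofs
import Literature.NumberTheory.EllipticCurves.ZpExtensionInertiaTorsionCyclotomicProofs
import Literature.NumberTheory.EllipticCurves.PadicCoeffIntegersQuotientFiniteProofs
import Literature.NumberTheory.EllipticCurves.SplitPrimeLocalGaloisTransportProofs
import Literature.NumberTheory.EllipticCurves.OrdinaryNewformDatumOrdinaryFrameProofs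
import Literature.NumberTheory.EllipticCurves.HeckeUnitRootNotRootOfUnityProofs
import Literature.NumberTheory.EllipticCurves.OrdinaryFiltrationIntegralFrameProofs
import Literature.NumberTheory.EllipticCurves.EisensteinNewformLevelRaisingOrdinaryProofs
import Literature.NumberTheory.EllipticCurves.CofreeContinuousRepNewform
import Literature.NumberTheory.EllipticCurves.NewformsCoeffFieldHolds
import Literature.NumberTheory.EllipticCurves.PadicCoeffIntegersFrobeniusData
import Literature.NumberTheory.GaloisRepresentations.PadicUnitPowersProofs
import Literature.NumberTheory.GaloisRepresentations.TeichmullerCharacter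
import Literature.NumberTheory.GaloisRepresentations.LocalGaloisGroupFrobeniusProofs
import Literature.NumberTheory.GaloisRepresentations.LocalKroneckerWeberInertiaProofs
import HarnessLib

/-!
# (FIX) ⇐ [Wiles 1988 Thm 2.2]: the v6 stub `stub_finiteFixedPartAnomalous` of line `erratum_chain` (crux 25505), GRANTED the named
# fact `Hida2000_thm326_ordinary_unitRoot`; hence S2♭♭ `stub_localDefectFiniteAnomalous` ⇐ the same (helper, `--supports 25505`)

Cell `bsd-stepL`, seat `bsd-stepL-imc-p1` (prover g23, 2026-08-28). Theorems only (no definition, no named fact, no `sorry`, no instance,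
no notation). THE FINAL ASSEMBLY of memo `LOCALDEFECT-25505-imc-p1-g23.md` §1ter: instantiate `FixAssembly.finite_fixed_of_frame`
(`ErratumRoadFiveFixedPartOfFrame`) at the erratum data. Inputs, all landed by this seat: the integral ordinary frame of `Δ.ρ` at
`(p)` from `Δ.fil` (`OrdinaryFiltration.exists_integralFrame`), its inertia/Frobenius values from the named fact through the datum's
attachedness (`OrdinaryNewformDatum.frobRoot_of_ordinaryFrame_of_thm326`, `det_toLocal_eq_of_mem_absInertia`), the transport
`Γ_{ℚ_p} ↝ Γ_{K_𝔭̄}` (`frame_transport_of_split`), cofree coordinates (`exists_cofree_coordinates`), the `σ₀ ∈ P` with `χ_cyc = −1`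
(`exists_localGroup_inertia_torsion_of_split`), proportionality/ramification on inertia (`absInertia_toAdd_mul_comm_of_split`,
`exists_absInertia_apply_ne_one_of_isAnticyclotomic`), exponent separation of the unit root (`PadicUnitPowers.…`, infinite order by
`pow_ne_one_of_root_heckePolynomial_padic` — no Deligne), and `B[c]` finite (`finite_setOf_smul_quotient_eq_zero`,
`finite_padicCoeffIntegers_quotient_span`).

* `finiteFixedPartAnomalous_of_thm326` — `Hida2000_thm326_ordinary_unitRoot → (FIX)` (the v6 stub statement verbatim after `→`);
* `stub_localDefectFiniteAnomalous_of_thm326` — `Hida2000_thm326_ordinary_unitRoot → S2♭♭` (the registered v4 stub verbatim after `→`),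
  by `LocalDefectAtData.stub_localDefectFiniteAnomalous_of_finiteFixed`.

HONEST FRAMING: CONDITIONAL on the printed theorem [Wiles 1988 Thm 2.2 ∕ Hida 2000 Thm 3.26 (2)] = the tree's unproved named fact
`Hida2000_thm326_ordinary_unitRoot`; nothing about BSD for any pair; closes: none (T7) — the registered stub has no such hypothesis,
so this file `--supports` the crux and the planner decides (v7 with the fact as a displayed hypothesis, or a discharge of the fact).

## References
* [JetchevSkinnerWan2017] §3.3 Case 3(b), §3.4 L.3.4.1; [Wiles1988] Thm 2.2; [Hida2000] Thm 3.26; [Greenberg1989] §1; [SerreLocalFields1979] IV §4.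
-/

noncomputable section

-- D-0017: single-problem summit, the namespace repeats the problem name by design.
set_option linter.dupNamespace false
set_option autoImplicit false

open scoped MatrixGroups Matrix ModularForm NumberField
open Filter Topology Field NumberField IsDedekindDomain CongruenceSubgroup UpperHalfPlane
open Literature.NumberTheory.GaloisRepresentations Literature.NumberTheory.GaloisRepresentations.IsNonarchimedeanLocalField
open Literature.NumberTheory.EllipticCurves Literature.NumberTheory.EllipticCurves.ModularForms
open Literature.NumberTheory.EllipticCurves.GreenbergSelmer Literature.NumberTheory.EllipticCurves.BigGaloisRep
open Literature.NumberTheory.EllipticCurves.ZpExtension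

namespace Summit.BirchSwinnertonDyer.BirchSwinnertonDyer.Theorems.ErratumThm23TwoVariable.FixFinal

/-- The prime `(p) ⊆ ℤ` below a place of a number field containing `p`, and the OTHER place above a prime with exactly two places.
[cite: NeukirchANT1999, Ch. I §8 Prop. (8.2)] -/
theorem exists_other_place {K : Type} [Field K] [NumberField K] {p : ℕ} [Fact p.Prime]
    {vbar : HeightOneSpectrum (𝓞 K)} (hvbar : ((p : ℕ) : 𝓞 K) ∈ vbar.asIdeal)
    (h2 : ((Ideal.span {(p : ℤ)}).primesOver (𝓞 K)).ncard = 2) :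
    ∃ v : HeightOneSpectrum (𝓞 K), ((p : ℕ) : 𝓞 K) ∈ v.asIdeal ∧ vbar ≠ v := by
  have hp : p.Prime := Fact.out
  -- `vbar` lies over `(p)`
  have hunder : ∀ (Q : Ideal (𝓞 K)), Q.IsPrime → ((p : ℕ) : 𝓞 K) ∈ Q → Q.under ℤ = Ideal.span {(p : ℤ)} := by
    intro Q hQ hpQ
    have hle : Ideal.span {(p : ℤ)} ≤ Q.under ℤ := by
      rw [Ideal.span_singleton_le_iff_mem, Ideal.under_def, Ideal.mem_comap, map_natCast]; exact hpQ
    have hmax : (Ideal.span {(p : ℤ)}).IsMaximal :=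
      PrincipalIdealRing.isMaximal_of_irreducible (Int.prime_iff_natAbs_prime.mpr (by simpa using hp)).irreducible
    exact (hmax.eq_of_le (Ideal.IsPrime.under ℤ Q).ne_top hle).symm
  have hmem : vbar.asIdeal ∈ (Ideal.span {(p : ℤ)}).primesOver (𝓞 K) :=
    ⟨vbar.isPrime, ⟨(hunder _ vbar.isPrime hvbar).symm⟩⟩
  obtain ⟨x, y, hxy, hset⟩ := Set.ncard_eq_two.mp h2
  -- the other element
  obtain ⟨Q, hQmem, hQne⟩ : ∃ Q ∈ (Ideal.span {(p : ℤ)}).primesOver (𝓞 K), Q ≠ vbar.asIdeal := by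
    rw [hset] at hmem ⊢
    rcases hmem with h | h
    · exact ⟨y, by simp, fun e ↦ hxy (by rw [e]; exact h.symm)⟩
    · exact ⟨x, by simp, fun e ↦ hxy (by rw [e, h])⟩
  have hQp : Q.IsPrime := hQmem.1
  have hpQ : ((p : ℕ) : 𝓞 K) ∈ Q := by
    have h := hQmem.2.over
    have h' : (p : ℤ) ∈ Q.under ℤ := by rw [← h]; exact Ideal.mem_span_singleton_self _
    rw [Ideal.under_def, Ideal.mem_comap, map_natCast] at h'
    exact h'
  have hQ0 : Q ≠ ⊥ := by
    intro h0; rw [h0] at hpQ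
    exact (NeZero.ne p) (by exact_mod_cast (Submodule.mem_bot (R := 𝓞 K)).mp hpQ)
  exact ⟨⟨Q, hQp, hQ0⟩, hpQ, fun e ↦ hQne (congrArg HeightOneSpectrum.asIdeal e).symm⟩

set_option maxHeartbeats 6000000 in
set_option synthInstance.maxHeartbeats 200000 in
/-- **(FIX) granted [Wiles 1988 Thm 2.2]**: for the erratum data in the `¬(dec)` corner — in fact for ANY `σ₁ ∈ ker κ ∖ ker κ'` without
the anomalous hypothesis — only finitely many `a ∈ A_g` are fixed by `P = ker κ| ∩ ker κ'|` and `σ₁`. The v6 stub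
`stub_finiteFixedPartAnomalous` verbatim, behind the named fact `Hida2000_thm326_ordinary_unitRoot`.
[cite: JetchevSkinnerWan2017, §3.3 Case 3(b) and §3.4 Lemma 3.4.1 (arXiv:1512.06894 pp. 13–14)] [cite: Wiles1988, Thm. 2.2]
[cite: Greenberg1989, §1 p. 98] [cite: SerreLocalFields1979, Ch. IV §4 Cor. 2 to Prop. 16] -/
theorem finiteFixedPartAnomalous_of_thm326 (hW : Hida2000_thm326_ordinary_unitRoot) :
    ∀ {p : ℕ} [Fact p.Prime] {M : ℕ} [NeZero M] {k : ℤ}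
      (g : CuspForm (CongruenceSubgroup.Gamma0 M) k) (ιg : coeffField g →+* PadicAlgCl p)
      (Δ : OrdinaryNewformDatum g p ιg)
      (K : Type) [Field K] [NumberField K] (𝔭bar : HeightOneSpectrum (𝓞 K)) (κ κ' : ZpExtension K p),
      IsNewform0 g → 2 ≤ k → Even k → ¬ p ∣ M → 3 < p →
      ‖ιg ⟨(UpperHalfPlane.qExpansion 1 ⇑g).coeff p, coeff_mem_coeffField g p⟩‖ = 1 →
      IsImaginaryQuadratic K → ((Ideal.span {(p : ℤ)}).primesOver (𝓞 K)).ncard = 2 →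
      ((p : ℕ) : 𝓞 K) ∈ 𝔭bar.asIdeal → κ.IsAnticyclotomic → κ'.IsCyclotomic →
      ∀ σ₁ : LocalGroup K (Sum.inl 𝔭bar), κ (localMap K (Sum.inl 𝔭bar) σ₁) = 1 →
        κ' (localMap K (Sum.inl 𝔭bar) σ₁) ≠ 1 →
        {a : Cofree Δ.ρ (padicCoeffField ιg) |
          (∀ σ : LocalGroup K (Sum.inl 𝔭bar), κ' (localMap K (Sum.inl 𝔭bar) σ) = 1 →
            κ (localMap K (Sum.inl 𝔭bar) σ) = 1 →
            (Δ.cofreeRepOver K) (localMap K (Sum.inl 𝔭bar) σ) a = a) ∧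
          (Δ.cofreeRepOver K) (localMap K (Sum.inl 𝔭bar) σ₁) a = a}.Finite := by
  intro p _ M _ k g ιg Δ K _ _ 𝔭bar κ κ' h1 h2 h3 h4 h5 h6 h7 h8 h9 h10 h11 σ₁ h12 h13
  classical
  have hp : p.Prime := Fact.out
  have hp2 : p ≠ 2 := by omega
  have hK2 : Module.finrank ℚ K = 2 := h7.1
  haveI : FiniteDimensional ℚ (coeffField g) := IsNewform0.finiteDimensional_coeffField_holds h1
  haveI : FiniteDimensional ℚ_[p] (padicCoeffField ιg) := GreenbergSelmer.finiteDimensional_padicCoeffField ιg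
  haveI : IsPrincipalIdealRing (padicCoeffIntegers ιg) := isPrincipalIdealRing_padicCoeffIntegers ιg
  obtain ⟨m, hm⟩ : ∃ m : ℕ, ((m : ℕ) : ℤ) = k - 1 := ⟨(k - 1).toNat, Int.toNat_of_nonneg (by omega)⟩
  have hmodd : Odd m := by
    obtain ⟨r, hr⟩ := h3
    refine ⟨(r - 1).toNat, ?_⟩
    have : (0 : ℤ) ≤ r - 1 := by omega
    zify; rw [Int.toNat_of_nonneg this]; omega
  -- notation-free: `𝒪 = padicCoeffIntegers ιg`, `F = padicCoeffField ιg`, `(padicCoeffIntegers.toPadicAlgCl ιg) : 𝒪 → ℚ̄_p`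
  have htoC_inj : Function.Injective (padicCoeffIntegers.toPadicAlgCl ιg) := fun x y hxy ↦ Subtype.ext (Subtype.ext hxy)
  /- (B1) the other place and the place of `ℚ` below `𝔭bar` -/
  obtain ⟨v, hpv, hne⟩ := exists_other_place h9 h8
  obtain ⟨u, hwu, hu⟩ := exists_heightOneSpectrum_rat_under hp h9
  have hw : (p : 𝓞 ℚ) ∈ u.asIdeal := by
    have h : ((p : ℕ) : 𝓞 ℚ) ∈ 𝔭bar.asIdeal.under (𝓞 ℚ) := by
      rw [Ideal.under_def, Ideal.mem_comap, map_natCast]; exact h9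
    rw [hwu] at h
    exact_mod_cast h
  /- (B2) the integral ordinary frame of `Δ.ρ` at `u` and its values -/
  obtain ⟨Q₀, hQ₀⟩ := OrdinaryFiltration.exists_integralFrame Δ.ρ u (Δ.fil u hw)
  -- the base change to `ℚ̄_p` and the mapped frame
  set ρ' := FramedRep.baseChange (padicCoeffIntegers.toPadicAlgCl ιg) continuous_toPadicAlgCl Δ.ρ with hρ'
  set Q₀' : GL (Fin 2) (PadicAlgCl p) := Matrix.GeneralLinearGroup.map (padicCoeffIntegers.toPadicAlgCl ιg) Q₀ with hQ₀'
  have hmapT : ∀ x : absoluteGaloisGroup (u.adicCompletion ℚ),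
      Q₀'⁻¹ * FramedGaloisRep.toLocal u ρ' x * Q₀' =
        Matrix.GeneralLinearGroup.map (padicCoeffIntegers.toPadicAlgCl ιg) (Q₀⁻¹ * Δ.ρ.toLocal u x * Q₀) := by
    intro x
    rw [map_mul, map_mul, map_inv, hQ₀', FramedGaloisRep.toLocal_apply, FramedGaloisRep.toLocal_apply, hρ',
      FramedRep.baseChange_apply]
  have hmapT_val : ∀ (x : absoluteGaloisGroup (u.adicCompletion ℚ)) (i j : Fin 2),
      (Q₀'⁻¹ * FramedGaloisRep.toLocal u ρ' x * Q₀').val i j = (padicCoeffIntegers.toPadicAlgCl ιg) ((Q₀⁻¹ * Δ.ρ.toLocal u x * Q₀).val i j) := by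
    intro x i j
    rw [hmapT]; rfl
  have hQ₀' : ∀ x : absoluteGaloisGroup (u.adicCompletion ℚ),
      (Q₀'⁻¹ * FramedGaloisRep.toLocal u ρ' x * Q₀').val 1 0 = 0 ∧
      (x ∈ absInertia (u.adicCompletion ℚ) → (Q₀'⁻¹ * FramedGaloisRep.toLocal u ρ' x * Q₀').val 1 1 = 1) := by
    intro x
    refine ⟨by rw [hmapT_val, (hQ₀ x).1, map_zero], fun hx ↦ by rw [hmapT_val, (hQ₀ x).2 hx, map_one]⟩
  /- (B3) transport to `Γ_{K_𝔭̄}` -/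
  obtain ⟨Q', hQ'⟩ := frame_transport_of_split hK2 hpv h9 hne hwu Δ.ρ Q₀
    (fun T ↦ T.val 1 0 = 0)
    (fun T ↦ (padicCoeffIntegers.toPadicAlgCl ιg) (T.val 1 1) ^ 2 -
        ιg ⟨(qExpansion 1 ⇑g).coeff p, coeff_mem_coeffField g p⟩ * (padicCoeffIntegers.toPadicAlgCl ιg) (T.val 1 1) +
      (p : PadicAlgCl p) ^ (k - 1) = 0)
    (fun _ T ↦ T.val 1 1 = 1) (fun _ _ _ h ↦ h)
    (fun x ↦ ⟨(hQ₀ x).1, fun hx ↦ (hQ₀ x).2 hx, fun hx ↦ by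
      have h := Δ.frobRoot_of_ordinaryFrame_of_thm326 hW h1 h2 h4 h6 hw Q₀' hQ₀' hx
      rw [hmapT_val] at h
      exact h⟩)
  -- the transported matrices
  obtain ⟨T, hTfun⟩ : ∃ T, T = fun τ : LocalGroup K (Sum.inl 𝔭bar) ↦
      Q'⁻¹ * Δ.ρ (absGaloisRestrict ℚ K (localMap K (Sum.inl 𝔭bar) τ)) * Q' := ⟨_, rfl⟩
  have hT : ∀ τ, T τ = Q'⁻¹ * Δ.ρ (absGaloisRestrict ℚ K (localMap K (Sum.inl 𝔭bar) τ)) * Q' := fun τ ↦ by rw [hTfun]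
  have hT10 : ∀ τ, (T τ).val 1 0 = 0 := fun τ ↦ by rw [hT]; exact (hQ' τ).1
  have hTI : ∀ τ, τ ∈ absInertia (𝔭bar.adicCompletion K) → (T τ).val 1 1 = 1 := fun τ hτ ↦ by
    rw [hT]; exact (hQ' τ).2.1 hτ
  have hTF : ∀ τ, IsAbsArithFrob τ → (padicCoeffIntegers.toPadicAlgCl ιg) ((T τ).val 1 1) ^ 2 -
      ιg ⟨(qExpansion 1 ⇑g).coeff p, coeff_mem_coeffField g p⟩ * (padicCoeffIntegers.toPadicAlgCl ιg) ((T τ).val 1 1) + (p : PadicAlgCl p) ^ (k - 1) = 0 :=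
    fun τ hτ ↦ by rw [hT]; exact (hQ' τ).2.2 hτ
  have hTmul : ∀ σ τ, T (σ * τ) = T σ * T τ := fun σ τ ↦ by
    simp only [hT, map_mul]; group
  have hTone : T 1 = 1 := by simp only [hT, map_one, mul_one, inv_mul_cancel]
  /- (B4) the inputs of `finite_fixed_of_frame` -/
  -- coordinates, in triangular form along `τ ↦ res (loc τ)`
  obtain ⟨Φ, hΦ⟩ := exists_cofree_coordinates_triangular (F := padicCoeffField ιg) Δ.ρ Q'
    (fun τ : LocalGroup K (Sum.inl 𝔭bar) ↦ absGaloisRestrict ℚ K (localMap K (Sum.inl 𝔭bar) τ))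
    (fun τ ↦ by have h := hT10 τ; rw [hT] at h; exact h)
  let χ : LocalGroup K (Sum.inl 𝔭bar) → padicCoeffIntegers ιg := fun τ ↦ (T τ).val 0 0
  let e : LocalGroup K (Sum.inl 𝔭bar) → padicCoeffIntegers ιg := fun τ ↦ (T τ).val 0 1
  let δ : LocalGroup K (Sum.inl 𝔭bar) → padicCoeffIntegers ιg := fun τ ↦ (T τ).val 1 1
  obtain ⟨ρA, hρA⟩ : ∃ ρA, ρA = (Δ.cofreeRepOver K).restrict (localMap K (Sum.inl 𝔭bar)) := ⟨_, rfl⟩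
  have hρA_apply : ∀ τ a, ρA τ a = (Δ.cofreeRepOver K) (localMap K (Sum.inl 𝔭bar) τ) a := fun τ a ↦ by
    rw [hρA, ContinuousRep.restrict_apply]
  have hΦ' : ∀ τ a, Φ (ρA τ a) = (χ τ • (Φ a).1 + e τ • (Φ a).2, δ τ • (Φ a).2) := by
    intro τ a
    have h := hΦ τ a
    -- `ρA τ a` is, by `rfl`, the argument of `Φ` in `h` (`restrict`, `cofreeRep_apply`, `smul_def` are all `rfl`)
    refine ((congrArg Φ (?_ : ρA τ a = _)).trans h).trans ?_
    · rw [hρA]; rfl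
    refine Prod.ext ?_ ?_
    · show _ = (T τ).val 0 0 • (Φ a).1 + (T τ).val 0 1 • (Φ a).2
      rw [hT]
    · show _ = (T τ).val 1 1 • (Φ a).2
      rw [hT]
  -- `σ₀ ∈ P` with `χ(σ₀) = -1`
  have hneg1 : ((-1 : ℤ_[p]ˣ)) ∈ CommGroup.torsion ℤ_[p]ˣ :=
    (CommGroup.mem_torsion _).mpr (isOfFinOrder_iff_pow_eq_one.mpr ⟨2, two_pos, by simp⟩)
  obtain ⟨σ₀', hσ₀'I, hχσ₀', hκ'σ₀', hκσ₀'⟩ :=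
    exists_localGroup_inertia_torsion_of_split hK2 hp2 hpv h9 hne κ κ' h11 (-1) hneg1
  have hχ₀ : χ σ₀' = -1 := by
    -- `χ(σ₀') = det T(σ₀') = det ρ(g) = χ_cyc(g)^{k−1} = (−1)^{k−1}` with `g = res(loc σ₀')`, via Ribet Prop. 2.2 over `K_coeff`
    haveI : IsModuleTopology ℚ_[p] (padicCoeffField ιg) := isModuleTopology_padicCoeffField
    have hg0 := isNewform0_ne_zero h1
    have hε : nebentypus (liftToGamma1 M k g) = 1 := nebentypus_liftToGamma1_holds M k hg0
    have hatt := Δ.isGaloisRepOfNewform1_baseChange_padicCoeffField h1 (by omega : 1 ≤ k)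
    have hdetF := Ribet1977.prop22_det_eq hatt hm (absGaloisRestrict ℚ K (localMap K (Sum.inl 𝔭bar) σ₀'))
    -- the nebentypus factor is `1`
    have hεc : nebentypusCoeff (liftToGamma1 M k g)
        (modNCyclotomicCharacter ℚ M (absGaloisRestrict ℚ K (localMap K (Sum.inl 𝔭bar) σ₀')) : ZMod M) = 1 := by
      apply Subtype.ext
      rw [coe_nebentypusCoeff, hε, MulChar.one_apply (Units.isUnit _)]
      rfl
    rw [hεc, map_one, one_mul, FramedRep.baseChange_apply,
      ← cyclotomicCharacter_eq_cyclotomicCharacter_rat_absGaloisRestrict K p (localMap K (Sum.inl 𝔭bar) σ₀'), hχσ₀',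
      Units.val_neg, Units.val_one, PadicInt.coe_neg, PadicInt.coe_one, map_neg, map_one, hmodd.neg_one_pow] at hdetF
    -- `det T(σ₀') = χ(σ₀')` and `det T = det ρ(g)`
    have h10 := hT10 σ₀'
    have h11 := hTI σ₀' hσ₀'I
    have hdetT : (T σ₀').val.det = χ σ₀' := by
      rw [Matrix.det_fin_two, h10, h11, mul_zero, sub_zero, mul_one]
    have hdetρ : (T σ₀').val.det = (Δ.ρ (absGaloisRestrict ℚ K (localMap K (Sum.inl 𝔭bar) σ₀'))).val.det := by
      rw [hT]; exact det_val_conj Q' _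
    have hval : ((χ σ₀' : padicCoeffIntegers ιg) : padicCoeffField ιg) = -1 := by
      rw [← hdetT, hdetρ, ← hdetF]
      exact RingHom.map_det (padicCoeffIntegers ιg).subtype (Δ.ρ (absGaloisRestrict ℚ K (localMap K (Sum.inl 𝔭bar) σ₀'))).val
    exact Subtype.ext hval
  have h2unit : IsUnit ((2 : padicCoeffIntegers ιg)) := by
    have hn2 : ‖((2 : ℕ) : PadicAlgCl p)‖ = 1 :=
      PadicAlgCl.norm_natCast_of_not_dvd (fun h ↦ hp2 ((Nat.prime_dvd_prime_iff_eq hp Nat.prime_two).mp h))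
    have h20 : ((2 : padicCoeffField ιg)) ≠ 0 := two_ne_zero
    have hmem : (2 : padicCoeffField ιg)⁻¹ ∈ padicCoeffIntegers ιg := by
      rw [mem_padicCoeffIntegers_iff]
      push_cast
      rw [norm_inv]
      have : ‖((2 : padicCoeffField ιg) : PadicAlgCl p)‖ = 1 := by exact_mod_cast hn2
      rw [this, inv_one]
    refine isUnit_iff_exists_inv.mpr ⟨⟨(2 : padicCoeffField ιg)⁻¹, hmem⟩, Subtype.ext ?_⟩
    change (2 : padicCoeffField ιg) * (2 : padicCoeffField ιg)⁻¹ = 1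
    exact mul_inv_cancel₀ h20
  have h₀ : ∃ σ, κ'.toContinuousMonoidHom.comp (localMap K (Sum.inl 𝔭bar)) σ = 1 ∧ κ.toContinuousMonoidHom.comp (localMap K (Sum.inl 𝔭bar)) σ = 1 ∧ IsUnit (χ σ - 1) := by
    refine ⟨σ₀', hκ'σ₀', hκσ₀', ?_⟩
    rw [hχ₀, show (-1 : padicCoeffIntegers ιg) - 1 = -2 by norm_num]
    exact h2unit.neg
  -- `δ` multiplicative, unital, continuous, unramified
  have hδmul : ∀ σ τ, δ (σ * τ) = δ σ * δ τ := by
    intro σ τ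
    change (T (σ * τ)).val 1 1 = (T σ).val 1 1 * (T τ).val 1 1
    rw [hTmul, Units.val_mul, Matrix.mul_apply, Fin.sum_univ_two]
    have h := hT10 σ
    rw [h, zero_mul, zero_add]
  have hδone : δ 1 = 1 := by
    change (T 1).val 1 1 = 1
    rw [hTone]; rfl
  have hδc : Continuous fun τ ↦ (padicCoeffIntegers.toPadicAlgCl ιg) (δ τ) := by
    have hc : Continuous fun τ : LocalGroup K (Sum.inl 𝔭bar) ↦ (T τ).val := by
      rw [hTfun]
      exact Units.continuous_val.comp
        ((continuous_const.mul ((map_continuous Δ.ρ).comp ((map_continuous (absGaloisRestrict ℚ K)).comp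
          (map_continuous (localMap K (Sum.inl 𝔭bar)))))).mul continuous_const)
    exact continuous_toPadicAlgCl.comp (hc.matrix_elem 1 1)
  have hδI : ∀ τ ∈ absInertia (𝔭bar.adicCompletion K), δ τ = 1 := fun τ hτ ↦ hTI τ hτ
  -- a Frobenius, and exponent separation of `δ(Frob)`
  obtain ⟨σ₀, hσ₀⟩ := exists_isAbsArithFrob_holds (F := 𝔭bar.adicCompletion K)
  have hroot := hTF σ₀ hσ₀
  have htors : ∀ n : ℕ, 0 < n → (padicCoeffIntegers.toPadicAlgCl ιg) (δ σ₀) ^ n ≠ 1 := fun n hn ↦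
    pow_ne_one_of_root_heckePolynomial_padic h1 h2 h4 ιg hroot hn
  -- `‖δ(σ₀)^N − 1‖ < 1` for the order `N` of `δ(σ₀)` in `(𝒪/p)ˣ`
  have hδunit : IsUnit (δ σ₀) := by
    have hdet : IsUnit (T σ₀).val.det := (T σ₀).isUnit.map Matrix.detMonoidHom
    rw [Matrix.det_fin_two] at hdet
    have h10 := hT10 σ₀
    rw [h10, mul_zero, sub_zero] at hdet
    exact isUnit_of_mul_isUnit_right hdet
  obtain ⟨N, hN, hαN⟩ : ∃ N : ℕ, 0 < N ∧ ‖(padicCoeffIntegers.toPadicAlgCl ιg) (δ σ₀) ^ N - 1‖ < 1 := by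
    haveI : Finite (padicCoeffIntegers ιg ⧸ Ideal.span {(p : padicCoeffIntegers ιg)}) := finite_padicCoeffIntegers_quotient_p ιg
    obtain ⟨uu, huu⟩ := hδunit
    let ub : (padicCoeffIntegers ιg ⧸ Ideal.span {(p : padicCoeffIntegers ιg)})ˣ := Units.map (Ideal.Quotient.mk (Ideal.span {(p : padicCoeffIntegers ιg)})).toMonoidHom uu
    obtain ⟨N, hN, hubN⟩ := (isOfFinOrder_of_finite ub).exists_pow_eq_one
    refine ⟨N, hN, ?_⟩
    have hubval : (ub : padicCoeffIntegers ιg ⧸ Ideal.span {(p : padicCoeffIntegers ιg)}) =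
        Ideal.Quotient.mk (Ideal.span {(p : padicCoeffIntegers ιg)}) (δ σ₀) := by
      simp only [ub, Units.coe_map, huu]
      rfl
    have hval : (Ideal.Quotient.mk (Ideal.span {(p : padicCoeffIntegers ιg)}) (δ σ₀)) ^ N = 1 := by
      have h := congrArg Units.val hubN
      rwa [Units.val_pow_eq_pow_val, Units.val_one, hubval] at h
    have h1' : Ideal.Quotient.mk (Ideal.span {(p : padicCoeffIntegers ιg)}) (δ σ₀ ^ N - 1) = 0 := by
      rw [map_sub, map_pow, map_one, hval, sub_self]
    rw [Ideal.Quotient.eq_zero_iff_mem, Ideal.mem_span_singleton'] at h1'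
    obtain ⟨d, hd⟩ := h1'
    have h2' : (padicCoeffIntegers.toPadicAlgCl ιg) (δ σ₀) ^ N - 1 = (p : PadicAlgCl p) * (padicCoeffIntegers.toPadicAlgCl ιg) d := by
      rw [← map_pow, ← map_one (padicCoeffIntegers.toPadicAlgCl ιg), ← map_sub, ← hd, map_mul, map_natCast, mul_comm]
    rw [h2', norm_mul]
    calc ‖(p : PadicAlgCl p)‖ * ‖(padicCoeffIntegers.toPadicAlgCl ιg) d‖ ≤ ‖(p : PadicAlgCl p)‖ * 1 :=
          mul_le_mul_of_nonneg_left (norm_toPadicAlgCl_le_one ιg d) (norm_nonneg _)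
      _ < 1 := by rw [mul_one]; exact PadicAlgCl.norm_natCast_self_lt_one
  have hα : ∀ a : ℕ → ℕ, Tendsto (fun n ↦ ((padicCoeffIntegers.toPadicAlgCl ιg) (δ σ₀)) ^ (a n)) atTop (𝓝 1) →
      Tendsto (fun n ↦ ((a n : ℕ) : ℤ_[p])) atTop (𝓝 0) := fun a ha ↦
    PadicUnitPowers.tendsto_natCast_padicInt_zero_of_tendsto_pow_of_norm_pow_sub_one_lt
      (fun n hn ↦ PadicAlgCl.norm_natCast_of_not_dvd hn) hN hαN htors ha
  -- inertia: proportionality and ramification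
  have hprop : ∀ σ ∈ absInertia (𝔭bar.adicCompletion K), ∀ τ ∈ absInertia (𝔭bar.adicCompletion K),
      (κ'.toContinuousMonoidHom.comp (localMap K (Sum.inl 𝔭bar)) σ).toAdd * (κ.toContinuousMonoidHom.comp (localMap K (Sum.inl 𝔭bar)) τ).toAdd =
        (κ.toContinuousMonoidHom.comp (localMap K (Sum.inl 𝔭bar)) σ).toAdd * (κ'.toContinuousMonoidHom.comp (localMap K (Sum.inl 𝔭bar)) τ).toAdd :=
    fun σ hσ τ hτ ↦ absInertia_toAdd_mul_comm_of_split hK2 hp2 hpv h9 hne κ' κ hσ hτ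
  have hram : ∃ τ ∈ absInertia (𝔭bar.adicCompletion K), κ.toContinuousMonoidHom.comp (localMap K (Sum.inl 𝔭bar)) τ ≠ 1 := by
    obtain ⟨τ, hτ, hne1⟩ := exists_absInertia_apply_ne_one_of_isAnticyclotomic h7 hp2 κ h10 h9
    exact ⟨τ, hτ, hne1⟩
  /- (B5) assemble -/
  have h12' : κ.toContinuousMonoidHom.comp (localMap K (Sum.inl 𝔭bar)) σ₁ = 1 := h12
  have h13' : κ'.toContinuousMonoidHom.comp (localMap K (Sum.inl 𝔭bar)) σ₁ ≠ 1 := h13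
  have key := FixAssembly.finite_fixed_of_frame ρA (κ'.toContinuousMonoidHom.comp (localMap K (Sum.inl 𝔭bar)))
    (κ.toContinuousMonoidHom.comp (localMap K (Sum.inl 𝔭bar)))
    Φ χ e δ hΦ' h₀ (padicCoeffIntegers.toPadicAlgCl ιg) hδmul hδone hδc hδI hσ₀ hα hprop hram
    (fun c hc ↦ by
      have hcF : (c : padicCoeffField ιg) ≠ 0 := fun h ↦ hc (Subtype.ext h)
      haveI := finite_padicCoeffIntegers_quotient_span ιg c hcF
      exact finite_setOf_smul_quotient_eq_zero c hcF)
    h12' h13'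
  refine key.subset fun a ha ↦ ⟨fun σ hσ' hσ ↦ ?_, ?_⟩
  · have h := ha.1 σ hσ' hσ
    rw [← hρA_apply] at h
    exact h
  · have h := ha.2
    rw [← hρA_apply] at h
    exact h

end Summit.BirchSwinnertonDyer.BirchSwinnertonDyer.Theorems.ErratumThm23TwoVariable.FixFinal

end
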